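import Mathlib
import HarnessLib
import Literature.Analysis.FluidPDE.SuitableWeak
import Literature.Analysis.FluidPDE.LocalTypeI
import Literature.Analysis.FluidPDE.SlabPressureNormalization
import Literature.Analysis.FluidPDE.ESSLocalHolderBlowupTop
import Summits.NavierStokesRegularity.NavierStokesRegularity.Theorems.RellichScarNoMildScarPairing

/-!
# No mild scar under Type I (route RellichScar, item `NoMildScar`): the blow-up limit vanishes at the top

Helper file for the proof of `Summit.NavierStokesRegularity.NavierStokesRegularity.Theses.RellichScar.NoMildScar`
(stmt-NavierStokesRegularity-11723).  THE KEY STEP of the blow-up argument: if the apex profile `u`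
has a scar `σ ∈ L³(B(0, r))` (`esssup_{(−δ,0)×K} |u − σ| → 0` for compact `K ∌ 0`), then every
`L³_loc` limit `w` of the zooms `u_{c_j}`, `c_j ↓ 0`, vanishes weakly at the final time:
for every test field `φ` and `ε > 0`, `|∫ ⟪w(s), φ⟫| ≤ ε` for a.e. `s ∈ (s₀, 0)`.  Indeed the
pairings `s ↦ ∫ ⟪u_{c_j}(s), φ⟫` share a modulus of continuity
(`exists_uniform_pairing_modulus_apexZoom`), tend as `s ↑ 0` to the pairings `ℓ_j = ∫ ⟪σ_{c_j}, φ⟫`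
of the zoomed scars `σ_c(y) = c σ(c y)` (`ae_pairing_sub_scar_le`), and `ℓ_j → 0` because `L³` is
scale critical: `ℓ_j = c_j⁻² ∫ ⟪1_{B_r} σ, φ(c_j⁻¹ ·)⟫ → 0` (the tree's `tendsto_apex_pairing_zero`,
Seregin 2014, (6.6.2) ⇒ (6.6.3)).  This is ESS 2003, §3 (3.13) / Seregin 2014, §6.6 with the `L³`
scar in place of the `L³` trace of an `L_{3,∞}` solution; the bookkeeping follows the tree's
`blowup_top_vanishing`.

* `integral_inner_indicator_zoom_eq` — `c⁻² ∫ ⟪1_{B_r} σ, φ(c⁻¹ ·)⟫ = ∫ ⟪σ_c, φ⟫` for `c ρ ≤ r`;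
* `top_vanishing_of_scar` — the statement above.

References: Escauriaza–Seregin–Šverák 2003, §3 (3.13); Seregin 2014, §6.6, (6.6.2)–(6.6.3).
-/

noncomputable section

-- the summit and its single sub-problem share the name (CONVENTIONS §1), as in every Theorems file
set_option linter.dupNamespace false

namespace Summit.NavierStokesRegularity.NavierStokesRegularity.Theorems.RellichScarNoMildScar

open MeasureTheory Set Function Metric Filter Topology TopologicalSpace
open scoped ENNReal NNReal InnerProductSpace RealInnerProductSpace
open Literature.Analysis Literature.Analysis.FluidPDE

local notation "E³" => EuclideanSpace ℝ (Fin 3)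

variable {u : ℝ → E³ → E³} {p : ℝ → E³ → ℝ} {G : ℝ → E³ → E³ →L[ℝ] E³}

/-! ### The pairings of the zoomed scars -/

/-- **The pairing of the zoomed scar as a rescaled pairing of the scar**: for `0 < c`, `c ρ ≤ r`
and `tsupport φ ⊆ B(0, ρ)`, `c⁻² ∫ ⟪1_{B(0,r)} σ (x), φ(c⁻¹ x)⟫ dx = ∫ ⟪c σ(c y), φ(y)⟫ dy`
(substitute `x = c y`; on the support of `φ` one has `c y ∈ B(0, r)`). [folklore] -/
theorem integral_inner_indicator_zoom_eq {σ φ : E³ → E³} {r ρ c : ℝ} (hc : 0 < c) (hcρ : c * ρ ≤ r)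
    (hφρ : tsupport φ ⊆ ball (0 : E³) ρ) :
    (c ^ 2)⁻¹ * ∫ x, ⟪(ball (0 : E³) r).indicator σ x, φ (c⁻¹ • (x - 0))⟫ =
      ∫ y, ⟪c • σ (c • y), φ y⟫ := by
  set vh : E³ → E³ := (ball (0 : E³) r).indicator σ with hvh
  -- the integrands agree after the substitution
  have hpt : ∀ y : E³, ⟪vh (c • y), φ (c⁻¹ • (c • y - 0))⟫ = ⟪σ (c • y), φ y⟫ := by
    intro y
    rw [sub_zero, smul_smul, inv_mul_cancel₀ hc.ne', one_smul]
    by_cases hy : c • y ∈ ball (0 : E³) r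
    · rw [hvh, indicator_of_mem hy]
    · have hyρ : y ∉ ball (0 : E³) ρ := by
        intro h
        refine hy ?_
        rw [mem_ball_zero_iff] at h ⊢
        rw [norm_smul, Real.norm_of_nonneg hc.le]
        nlinarith
      have hφ0 : φ y = 0 := image_eq_zero_of_notMem_tsupport fun h => hyρ (hφρ h)
      simp [hφ0]
  have hsub := Measure.integral_comp_smul (μ := (volume : Measure E³))
    (fun x : E³ => ⟪vh x, φ (c⁻¹ • (x - 0))⟫) c
  rw [finrank_euclideanSpace_fin] at hsub
  simp only [hpt] at hsub
  -- `∫ f = |c³| ∫ f(c ·)`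
  have hc3 : |(c ^ 3)⁻¹| = (c ^ 3)⁻¹ := abs_of_pos (by positivity)
  rw [hc3] at hsub
  have e1 : ∫ x, ⟪vh x, φ (c⁻¹ • (x - 0))⟫ = c ^ 3 * ∫ y, ⟪σ (c • y), φ y⟫ := by
    have h := congrArg (fun t : ℝ => c ^ 3 * t) hsub
    simp only [smul_eq_mul, ← mul_assoc, mul_inv_cancel₀ (pow_ne_zero 3 hc.ne'), one_mul] at h
    exact h.symm
  rw [e1, ← mul_assoc]
  have e2 : (c ^ 2)⁻¹ * c ^ 3 = c := by field_simp
  rw [e2, ← integral_const_mul]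
  refine integral_congr_ae (Eventually.of_forall fun y => ?_)
  show c * ⟪σ (c • y), φ y⟫ = ⟪c • σ (c • y), φ y⟫
  rw [real_inner_smul_left]

/-! ### The limit vanishes at the final time -/

/-- **The blow-up limit of an apex profile with an `L³` scar vanishes at the final time, weakly**
(ESS 2003, §3 (3.13); Seregin 2014, §6.6, (6.6.3) "`u(·,0) = 0`", with the scar in place of the
`L³` trace).  Let `(u, p)` be a suitable weak solution on the backward slab with weak gradient `G`
and `𝐈 < ∞`, whose scar off the origin is `σ ∈ L³(B(0, r))`; let `c_j ↓ 0` be scales and `w` an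
`L³(Q(0, a))` limit of the zooms `u_{c_j}` for every `a > 0`.  Then for every test field `φ` and
`ε > 0` there is `s₀ < 0` with `|∫ ⟪w(s), φ⟫| ≤ ε` for a.e. `s ∈ (s₀, 0)`.
[cite: EscauriazaSereginSverak2003, §3 (3.13)] [cite: Seregin2014, §6.6 (6.6.3)] -/
theorem top_vanishing_of_scar
    (hsw : IsSuitableWeakSolutionOn (slab E³ (Iio 0) isOpen_Iio) 1 0 u p)
    (hwg : HasWeakSpatialGradientOn (slab E³ (Iio 0) isOpen_Iio) u G)
    (hI : typeIBound (Iio (0 : ℝ) ×ˢ univ) u p G < ⊤)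
    {σ : E³ → E³} {r : ℝ} (hr : 0 < r) (hσ : MemLp σ 3 (volume.restrict (ball (0 : E³) r)))
    (hscar : ∀ K : Set E³, IsCompact K → (0 : E³) ∉ K →
      Tendsto (fun δ : ℝ => eLpNorm (fun z : ℝ × E³ => u z.1 z.2 - σ z.2) ⊤
        (volume.restrict (Ioo (-δ) 0 ×ˢ K))) (𝓝[>] 0) (𝓝 0))
    {c : ℕ → ℝ} (hcpos : ∀ j, 0 < c j) (hc0 : Tendsto c atTop (𝓝 0))
    {w : ℝ → E³ → E³}
    (hwm : ∀ a : ℝ, 0 < a → MemLp (uncurry w) 3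
      (volume.restrict (parabolicCylinder a (0 : ℝ × E³))))
    (hconv : ∀ a : ℝ, 0 < a → Tendsto (fun j => eLpNorm
        (uncurry (c j • stPull (c j ^ 2) (c j) 0 (0 : E³) u) - uncurry w) 3
        (volume.restrict (parabolicCylinder a (0 : ℝ × E³)))) atTop (𝓝 0))
    {φ : E³ → E³} (hφ : ContDiff ℝ (⊤ : ℕ∞) φ) (hφc : HasCompactSupport φ) {ε : ℝ} (hε : 0 < ε) :
    ∃ s₀ : ℝ, s₀ < 0 ∧ ∀ᵐ s ∂(volume.restrict (Ioo s₀ 0)), |∫ y, ⟪w s y, φ y⟫| ≤ ε := by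
  classical
  set I : ℝ≥0∞ := typeIBound (Iio (0 : ℝ) ×ˢ (univ : Set E³)) u p G with hIdef
  have hItop : I ≠ ⊤ := hI.ne
  -- ## the radius `ρ ≥ 1` containing the support of `φ`, and the bounds of `φ`
  obtain ⟨R, hR⟩ := hφc.isCompact.isBounded.subset_closedBall (0 : E³)
  set ρ : ℝ := max 1 (R + 1) with hρdef
  have hρ1 : 1 ≤ ρ := le_max_left _ _
  have hρ : 0 < ρ := one_pos.trans_le hρ1
  have hφρ : tsupport φ ⊆ ball (0 : E³) ρ := fun x hx =>
    (closedBall_subset_ball (by rw [hρdef]; exact lt_of_lt_of_le (by linarith) (le_max_right _ _))) (hR hx)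
  have hηt : FunctionSpaces.IsTestFunctionOn (⟨ball 0 ρ, isOpen_ball⟩ : Opens E³) φ := ⟨hφ, hφc, hφρ⟩
  obtain ⟨K₀, K₁, K₂, hK₀, -, -⟩ := exists_bounds_of_isTestFunctionOn hηt
  have hK₀0 : 0 ≤ K₀ := (norm_nonneg _).trans (hK₀ 0)
  -- ## the uniform modulus
  obtain ⟨A, B, hA, hB, hmod⟩ := exists_uniform_pairing_modulus_apexZoom hsw hI hφ hφc hρ1 hφρ
  set ω : ℝ → ℝ := fun d => A * d + B * d ^ (1 / 3 : ℝ) with hω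
  have hωmono : ∀ x y : ℝ, 0 ≤ x → x ≤ y → ω x ≤ ω y := by
    intro x y hx hxy
    simp only [hω]
    exact add_le_add (mul_le_mul_of_nonneg_left hxy hA)
      (mul_le_mul_of_nonneg_left (Real.rpow_le_rpow hx hxy (by norm_num)) hB)
  -- ## the scales, from `j₀` on: `c_j ρ ≤ r / 2`
  obtain ⟨j₀, hj₀⟩ := (hc0.eventually (Iic_mem_nhds (show (0 : ℝ) < r / (2 * ρ) by positivity))).exists_forall_of_atTop
  set μ : ℕ → ℝ := fun j => c (j + j₀) with hμdef
  have hμpos : ∀ j, 0 < μ j := fun j => hcpos _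
  have hρμ : ∀ j, μ j * ρ ≤ r := by
    intro j
    have h1 : μ j ≤ r / (2 * ρ) := hj₀ _ (Nat.le_add_left _ _)
    calc μ j * ρ ≤ r / (2 * ρ) * ρ := mul_le_mul_of_nonneg_right h1 hρ.le
      _ = r / 2 := by field_simp
      _ ≤ r := by linarith
  have hμ0 : Tendsto μ atTop (𝓝 0) := hc0.comp (tendsto_add_atTop_nat j₀)
  set U : ℕ → ℝ → E³ → E³ := fun j => (μ j) • stPull ((μ j) ^ 2) (μ j) 0 (0 : E³) u with hU
  set Sg : ℕ → E³ → E³ := fun j y => μ j • σ (μ j • y) with hSg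
  -- ## the data of the zooms
  have hbdU : ∀ j, typeIBound (Iio (0 : ℝ) ×ˢ (univ : Set E³)) (U j)
      ((μ j) ^ 2 • stPull ((μ j) ^ 2) (μ j) 0 (0 : E³) p)
      ((μ j) ^ 2 • stPull ((μ j) ^ 2) (μ j) 0 (0 : E³) G) ≤ I := fun j =>
    (typeIBound_lowerHalf_nsZoom (hμpos j) u p G).le
  have hAU : ∀ j, ∀ η : ℝ, 0 < η → ∀ᵐ s ∂(volume.restrict (Ioo (-η ^ 2) 0)),
      ∫⁻ y in ball (0 : E³) η, ‖U j s y‖ₑ ^ 2 ≤ ENNReal.ofReal η * I := fun j η hη =>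
    ae_lintegral_ball_sq_le (hbdU j) hη
  have hscU : ∀ j, ∀ K : Set E³, IsCompact K → (0 : E³) ∉ K →
      Tendsto (fun δ : ℝ => eLpNorm (fun z : ℝ × E³ => U j z.1 z.2 - Sg j z.2) ⊤
        (volume.restrict (Ioo (-δ) 0 ×ˢ K))) (𝓝[>] 0) (𝓝 0) := fun j K hK h0 =>
    zoom_scar_tendsto (hμpos j) hscar hK h0
  -- ## the zoomed scars: measurability, `L¹(B(0,ρ))`, and `ℓ_j → 0`
  set vh : E³ → E³ := (ball (0 : E³) r).indicator σ with hvh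
  have hvh3 : MemLp vh 3 volume := (memLp_indicator_iff_restrict measurableSet_ball).2 hσ
  have hqmp : ∀ j, Measure.QuasiMeasurePreserving (fun y : E³ => μ j • y) volume volume := by
    intro j
    refine ⟨measurable_const_smul (μ j), ?_⟩
    rw [Measure.map_addHaar_smul volume (hμpos j).ne']
    exact Measure.smul_absolutelyContinuous
  have hSg_eq : ∀ j, ∀ y ∈ ball (0 : E³) ρ, Sg j y = μ j • vh (μ j • y) := by
    intro j y hy
    have hμy : μ j • y ∈ ball (0 : E³) r := by
      rw [mem_ball_zero_iff] at hy ⊢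
      rw [norm_smul, Real.norm_of_nonneg (hμpos j).le]
      calc μ j * ‖y‖ < μ j * ρ := mul_lt_mul_of_pos_left hy (hμpos j)
        _ ≤ r := hρμ j
    show μ j • σ (μ j • y) = μ j • vh (μ j • y)
    rw [hvh, indicator_of_mem hμy]
  have hSgm : ∀ j, AEStronglyMeasurable (Sg j) (volume.restrict (ball (0 : E³) ρ)) := by
    intro j
    have h1 : AEStronglyMeasurable (fun y : E³ => μ j • vh (μ j • y)) volume :=
      (hvh3.1.comp_quasiMeasurePreserving (hqmp j)).const_smul (μ j)
    refine h1.restrict.congr ?_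
    filter_upwards [ae_restrict_mem measurableSet_ball] with y hy
    exact (hSg_eq j y hy).symm
  have hσ1 : ∫⁻ x in ball (0 : E³) r, ‖σ x‖ₑ < ⊤ := by
    haveI : IsFiniteMeasure (volume.restrict (ball (0 : E³) r)) :=
      isFiniteMeasure_restrict.2 measure_ball_lt_top.ne
    exact (hσ.integrable (by norm_num)).2
  have hSg1 : ∀ j, ∫⁻ y in ball (0 : E³) ρ, ‖Sg j y‖ₑ < ⊤ := by
    intro j
    have e : ∀ y, ‖Sg j y‖ₑ = ENNReal.ofReal (μ j) * (fun x => ‖σ x‖ₑ) (μ j • y) := by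
      intro y
      show ‖μ j • σ (μ j • y)‖ₑ = _
      rw [enorm_smul, Real.enorm_eq_ofReal (hμpos j).le]
    simp_rw [e]
    have h1 : ∫⁻ y in ball (0 : E³) ρ, ‖σ (μ j • y)‖ₑ =
        ENNReal.ofReal (μ j ^ 3)⁻¹ * ∫⁻ x in ball (0 : E³) (μ j * ρ), ‖σ x‖ₑ :=
      lintegral_ball_comp_smul (hμpos j) (fun x => ‖σ x‖ₑ) ρ
    rw [lintegral_const_mul' _ _ ENNReal.ofReal_ne_top, h1]
    refine ENNReal.mul_lt_top ENNReal.ofReal_lt_top (ENNReal.mul_lt_top ENNReal.ofReal_lt_top ?_)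
    exact lt_of_le_of_lt (lintegral_mono_set (ball_subset_ball (hρμ j))) hσ1
  set ℓ : ℕ → ℝ := fun j => ∫ y, ⟪Sg j y, φ y⟫ with hℓ
  have hℓ0 : Tendsto ℓ atTop (𝓝 0) := by
    have h := tendsto_apex_pairing_zero hvh3 hK₀ hφρ hρ (0 : E³) hμpos hμ0
    refine (tendsto_congr fun j => ?_).1 h
    exact integral_inner_indicator_zoom_eq (hμpos j) (hρμ j) hφρ
  -- ## the pairings of the rescaled velocities
  set pair : ℕ → ℝ → ℝ := fun j s => ∫ y, ⟪U j s y, φ y⟫ with hpair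
  -- the cylinder `Q(ρ)` and the classes of `w`, `U_j` on it
  set Iρ : Set ℝ := Ioo (-ρ ^ 2) 0 with hIρ
  set Bρ : Set E³ := ball 0 ρ with hBρ
  have hQ : parabolicCylinder ρ (0 : ℝ × E³) = Iρ ×ˢ Bρ := by
    rw [parabolicCylinder, hIρ, hBρ]; simp
  set μQ : Measure (ℝ × E³) := volume.restrict (Iρ ×ˢ Bρ) with hμQ
  have hμQprod : μQ = (volume.restrict Iρ).prod (volume.restrict Bρ) := by
    rw [hμQ, Measure.prod_restrict, ← Measure.volume_eq_prod]
  haveI : IsFiniteMeasure μQ := by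
    refine ⟨?_⟩
    rw [hμQ, Measure.restrict_apply_univ, ← hQ]
    exact lt_of_le_of_lt (measure_mono (parabolicCylinder_subset_Icc_prod_closedBall _ _))
      (isCompact_Icc_prod_closedBall _ _).measure_lt_top
  set pw : ℝ → ℝ := fun s => ∫ y, ⟪w s y, φ y⟫ with hpw
  have hwm' : MemLp (uncurry w) 3 μQ := by rw [hμQ, ← hQ]; exact hwm ρ hρ
  have hUm' : ∀ j, MemLp (uncurry (U j)) 3 μQ := by
    intro j
    refine ⟨?_, ?_⟩
    · rw [hμQ, ← hQ]
      exact (zoom_hasWeakSpatialGradientOn_slab hwg (hμpos j)).locallyIntegrableOn.aestronglyMeasurable.mono_measure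
        (Measure.restrict_mono (parabolicCylinder_subset_lowerHalf le_rfl ρ) le_rfl)
    · rw [hμQ, ← hQ]
      refine lt_of_le_of_lt (eLpNorm_velocity_slab_le hρ
        ((μ j) ^ 2 • stPull ((μ j) ^ 2) (μ j) 0 (0 : E³) p)
        ((μ j) ^ 2 • stPull ((μ j) ^ 2) (μ j) 0 (0 : E³) G)) ?_
      exact ENNReal.rpow_lt_top_of_nonneg (by norm_num) (ENNReal.mul_ne_top
        (ENNReal.pow_ne_top ENNReal.ofReal_ne_top) (ne_top_of_le_ne_top hItop (hbdU j)))
  -- slice integrability, a.e. in `s`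
  have hint_w : ∀ᵐ s ∂(volume.restrict Iρ), Integrable (fun y => w s y) (volume.restrict Bρ) := by
    have h1 : Integrable (uncurry w) μQ := hwm'.integrable (by norm_num)
    rw [hμQprod] at h1
    filter_upwards [h1.prod_right_ae] with s hs
    exact hs
  have hint_U : ∀ j, ∀ᵐ s ∂(volume.restrict Iρ), Integrable (fun y => U j s y) (volume.restrict Bρ) := by
    intro j
    have h1 : Integrable (uncurry (U j)) μQ := (hUm' j).integrable (by norm_num)
    rw [hμQprod] at h1
    filter_upwards [h1.prod_right_ae] with s hs
    exact hs
  -- ## KEY: `|pair_j(s) - ℓ_j| ≤ ω(|s|)` a.e. on `]-ρ², 0[`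
  have hkey : ∀ j, ∀ᵐ s ∂(volume.restrict Iρ), |pair j s - ℓ j| ≤ ω (|s|) := by
    intro j
    obtain ⟨S, hS, hSmod⟩ := hmod (μ j) (hμpos j)
    filter_upwards [hS, ae_restrict_mem measurableSet_Ioo] with s hsS hsI
    refine le_of_forall_pos_le_add fun ε' hε' => ?_
    -- the pairings tend to the pairing of the zoomed scar, at accuracy `ε'`
    obtain ⟨τ, hτ, htr'⟩ := ae_pairing_sub_scar_le (U := U j) (sg := Sg j) hItop hρ1 (hAU j)
      (hint_U j) (hSgm j) (hSg1 j) (hscU j) hφ.continuous hK₀ hφρ hε'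
    -- a good `σ' ∈ ]s, 0[`
    have hsneg : s < 0 := hsI.2
    set s₁ : ℝ := max s (-τ) with hs₁
    have hs₁0 : s₁ < 0 := max_lt hsneg (by linarith)
    have hGσ : ∀ᵐ σ' ∂(volume.restrict (Ioo s₁ 0)), σ' ∈ S ∩ {σ' | |pair j σ' - ℓ j| ≤ ε'} := by
      have h1 : Ioo s₁ 0 ⊆ Iρ := Ioo_subset_Ioo ((hsI.1.le).trans (le_max_left _ _)) le_rfl
      have h2 : Ioo s₁ 0 ⊆ Ioo (-τ) 0 := Ioo_subset_Ioo (le_max_right _ _) le_rfl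
      filter_upwards [ae_restrict_of_ae_restrict_of_subset h1 hS,
        ae_restrict_of_ae_restrict_of_subset h2 htr'] with σ' h3 h4
      exact ⟨h3, h4⟩
    obtain ⟨σ', ⟨hσS, hσtr⟩, hσ1, -, hσ0⟩ := exists_mem_fullMeasure_near_top hs₁0 hGσ one_pos
    have hsσ : s < σ' := (le_max_left _ _).trans_lt hσ1
    -- the estimate
    have h5 := hSmod s hsS σ' hσS
    have hd : |s - σ'| = σ' - s := by rw [abs_sub_comm]; exact abs_of_pos (by linarith)
    rw [hd] at h5
    have h6 : ω (σ' - s) ≤ ω (|s|) := by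
      refine hωmono _ _ (by linarith) ?_
      rw [abs_of_neg hsneg]; linarith
    calc |pair j s - ℓ j| ≤ |pair j s - pair j σ'| + |pair j σ' - ℓ j| := abs_sub_le _ _ _
      _ ≤ ω (σ' - s) + ε' := add_le_add h5 hσtr
      _ ≤ ω (|s|) + ε' := add_le_add h6 le_rfl
  -- ## the pairings converge to the pairing of `w`, a.e. along a subsequence
  have hconv' : Tendsto (fun j => eLpNorm (uncurry (U j) - uncurry w) 3 μQ) atTop (𝓝 0) := by
    rw [hμQ, ← hQ]
    exact (hconv ρ hρ).comp (tendsto_add_atTop_nat j₀)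
  -- the `L¹(]-ρ²,0[)` distance of the pairings is controlled by `‖U_j - w‖_{L³(Q(ρ))}`
  have hφm : AEStronglyMeasurable φ (volume.restrict Bρ) := hφ.continuous.aestronglyMeasurable
  have hinner_int : ∀ {f : E³ → E³},
      Integrable f (volume.restrict Bρ) → Integrable (fun y => ⟪f y, φ y⟫) (volume.restrict Bρ) := by
    intro f hf
    refine Integrable.mono' (hf.norm.mul_const K₀) (hf.1.inner hφm) (Eventually.of_forall fun y => ?_)
    calc ‖⟪f y, φ y⟫‖ ≤ ‖f y‖ * ‖φ y‖ := norm_inner_le_norm _ _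
      _ ≤ ‖f y‖ * K₀ := mul_le_mul_of_nonneg_left (hK₀ _) (norm_nonneg _)
  have hdiff : ∀ j, ∀ᵐ s ∂(volume.restrict Iρ),
      pair j s - pw s = ∫ y in Bρ, ⟪U j s y - w s y, φ y⟫ := by
    intro j
    filter_upwards [hint_w, hint_U j] with s hws hUs
    rw [hpair, hpw]
    dsimp only
    rw [integral_inner_eq_setIntegral_of_tsupport hφρ, integral_inner_eq_setIntegral_of_tsupport hφρ,
      ← integral_sub (hinner_int hUs) (hinner_int hws)]
    refine integral_congr_ae (Eventually.of_forall fun y => ?_)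
    show ⟪U j s y, φ y⟫ - ⟪w s y, φ y⟫ = ⟪U j s y - w s y, φ y⟫
    rw [inner_sub_left]
  have hF_int : ∀ j, Integrable (fun z : ℝ × E³ => ⟪U j z.1 z.2 - w z.1 z.2, φ z.2⟫)
      ((volume.restrict Iρ).prod (volume.restrict Bρ)) := by
    intro j
    have hD : Integrable (uncurry (U j) - uncurry w) ((volume.restrict Iρ).prod (volume.restrict Bρ)) := by
      rw [← hμQprod]; exact ((hUm' j).sub hwm').integrable (by norm_num)
    have hφm2 : AEStronglyMeasurable (fun z : ℝ × E³ => φ z.2)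
        ((volume.restrict Iρ).prod (volume.restrict Bρ)) :=
      (hφ.continuous.comp continuous_snd).aestronglyMeasurable
    refine Integrable.mono' (hD.norm.mul_const K₀) (hD.1.inner hφm2) (Eventually.of_forall fun z => ?_)
    calc ‖⟪U j z.1 z.2 - w z.1 z.2, φ z.2⟫‖ ≤ ‖U j z.1 z.2 - w z.1 z.2‖ * ‖φ z.2‖ := norm_inner_le_norm _ _
      _ ≤ ‖(uncurry (U j) - uncurry w) z‖ * K₀ := mul_le_mul_of_nonneg_left (hK₀ _) (norm_nonneg _)
  have hdiff_int : ∀ j, Integrable (fun s => pair j s - pw s) (volume.restrict Iρ) := by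
    intro j
    have h1 := (hF_int j).integral_prod_left
    exact h1.congr ((hdiff j).mono fun s hs => hs.symm)
  have hpairL1 : ∀ j, eLpNorm (fun s => pair j s - pw s) 1 (volume.restrict Iρ) ≤
      ENNReal.ofReal K₀ * (eLpNorm (uncurry (U j) - uncurry w) 3 μQ * μQ univ ^ (2 / 3 : ℝ)) := by
    intro j
    have hpt : ∀ᵐ s ∂(volume.restrict Iρ), ‖pair j s - pw s‖ₑ ≤
        ENNReal.ofReal K₀ * ∫⁻ y in Bρ, ‖U j s y - w s y‖ₑ := by
      filter_upwards [hdiff j] with s hs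
      rw [hs]
      refine (enorm_integral_le_lintegral_enorm _).trans ?_
      rw [← lintegral_const_mul' _ _ ENNReal.ofReal_ne_top]
      refine lintegral_mono fun y => ?_
      rw [← ofReal_norm, ← ofReal_norm, ← ENNReal.ofReal_mul hK₀0]
      refine ENNReal.ofReal_le_ofReal ?_
      calc ‖⟪U j s y - w s y, φ y⟫‖ ≤ ‖U j s y - w s y‖ * ‖φ y‖ := norm_inner_le_norm _ _
        _ ≤ ‖U j s y - w s y‖ * K₀ := mul_le_mul_of_nonneg_left (hK₀ _) (norm_nonneg _)
        _ = K₀ * ‖U j s y - w s y‖ := mul_comm _ _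
    have hDm : AEMeasurable (fun z : ℝ × E³ => ‖(uncurry (U j) - uncurry w) z‖ₑ)
        ((volume.restrict Iρ).prod (volume.restrict Bρ)) := by
      rw [← hμQprod]; exact ((hUm' j).sub hwm').1.enorm
    have hT : ∫⁻ s in Iρ, ∫⁻ y in Bρ, ‖U j s y - w s y‖ₑ = ∫⁻ z, ‖(uncurry (U j) - uncurry w) z‖ₑ ∂μQ := by
      rw [hμQprod, lintegral_prod _ hDm]
      rfl
    rw [eLpNorm_one_eq_lintegral_enorm]
    calc ∫⁻ s, ‖pair j s - pw s‖ₑ ∂volume.restrict Iρ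
        ≤ ∫⁻ s in Iρ, ENNReal.ofReal K₀ * ∫⁻ y in Bρ, ‖U j s y - w s y‖ₑ := lintegral_mono_ae hpt
      _ = ENNReal.ofReal K₀ * ∫⁻ z, ‖(uncurry (U j) - uncurry w) z‖ₑ ∂μQ := by
          rw [lintegral_const_mul' _ _ ENNReal.ofReal_ne_top, hT]
      _ = ENNReal.ofReal K₀ * eLpNorm (uncurry (U j) - uncurry w) 1 μQ := by rw [eLpNorm_one_eq_lintegral_enorm]
      _ ≤ ENNReal.ofReal K₀ * (eLpNorm (uncurry (U j) - uncurry w) 3 μQ * μQ univ ^ (2 / 3 : ℝ)) := by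
          refine mul_le_mul' le_rfl ?_
          have := eLpNorm_le_eLpNorm_mul_rpow_measure_univ (p := 1) (q := 3) (by norm_num)
            ((hUm' j).sub hwm').1
          rw [ENNReal.toReal_one, ENNReal.toReal_ofNat, show (1 / 1 - 1 / 3 : ℝ) = 2 / 3 by norm_num] at this
          exact this
  have hL1 : Tendsto (fun j => eLpNorm (fun s => pair j s - pw s) 1 (volume.restrict Iρ)) atTop (𝓝 0) := by
    have hfin : μQ univ ^ (2 / 3 : ℝ) ≠ ∞ := ENNReal.rpow_ne_top_of_nonneg (by norm_num) (measure_ne_top _ _)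
    have h1 : Tendsto (fun j => ENNReal.ofReal K₀ * (eLpNorm (uncurry (U j) - uncurry w) 3 μQ * μQ univ ^ (2 / 3 : ℝ)))
        atTop (𝓝 0) := by
      have h2 := ENNReal.Tendsto.mul_const hconv' (Or.inr hfin)
      rw [zero_mul] at h2
      have h3 := ENNReal.Tendsto.const_mul (a := ENNReal.ofReal K₀) h2 (Or.inr ENNReal.ofReal_ne_top)
      rwa [mul_zero] at h3
    exact tendsto_of_tendsto_of_tendsto_of_le_of_le tendsto_const_nhds h1 (fun j => bot_le) hpairL1
  have hTIM : TendstoInMeasure (volume.restrict Iρ) (fun j s => pair j s - pw s) atTop (fun _ => (0 : ℝ)) := by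
    refine tendstoInMeasure_of_tendsto_eLpNorm one_ne_zero (fun j => (hdiff_int j).1) aestronglyMeasurable_const ?_
    refine (tendsto_congr fun j => ?_).1 hL1
    congr 1
    funext s
    simp
  obtain ⟨ns, hns, hae⟩ := hTIM.exists_seq_tendsto_ae
  -- ## `|pw(s)| ≤ ω(|s|)` a.e.
  have hpw_le : ∀ᵐ s ∂(volume.restrict Iρ), |pw s| ≤ ω (|s|) := by
    have hall : ∀ᵐ s ∂(volume.restrict Iρ), ∀ j, |pair j s - ℓ j| ≤ ω (|s|) := ae_all_iff.2 hkey
    filter_upwards [hall, hae] with s hs1 hs2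
    have h1 : Tendsto (fun k => pair (ns k) s - ℓ (ns k)) atTop (𝓝 (pw s - 0)) := by
      have h3 : Tendsto (fun k => pair (ns k) s - pw s) atTop (𝓝 0) := hs2
      have h4 : Tendsto (fun k => pair (ns k) s) atTop (𝓝 (pw s)) := by
        have := h3.add_const (pw s)
        simpa using this
      exact h4.sub (hℓ0.comp hns.tendsto_atTop)
    rw [sub_zero] at h1
    exact le_of_tendsto' h1.abs fun k => hs1 (ns k)
  -- ## the choice of `s₀`
  obtain ⟨d, hd, hdω⟩ := exists_modulus_le hA hB hε
  set s₀ : ℝ := -min d (ρ ^ 2 / 2) with hs₀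
  have hs₀neg : s₀ < 0 := by rw [hs₀, neg_lt_zero]; exact lt_min hd (by positivity)
  have hs₀I : Ioo s₀ 0 ⊆ Iρ := by
    refine Ioo_subset_Ioo ?_ le_rfl
    rw [hs₀, neg_le_neg_iff]
    have := min_le_right d (ρ ^ 2 / 2)
    nlinarith
  refine ⟨s₀, hs₀neg, ?_⟩
  filter_upwards [ae_restrict_of_ae_restrict_of_subset hs₀I hpw_le, ae_restrict_mem measurableSet_Ioo] with s hs hsI'
  refine hs.trans (hdω _ (abs_nonneg s) ?_)
  rw [abs_of_neg hsI'.2]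
  have := min_le_left d (ρ ^ 2 / 2)
  linarith [hsI'.1]

end Summit.NavierStokesRegularity.NavierStokesRegularity.Theorems.RellichScarNoMildScar

end
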